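import Summits.BirchSwinnertonDyer.BirchSwinnertonDyer.Theses.AlignedTransportAtTwo
import Summits.BirchSwinnertonDyer.BirchSwinnertonDyer.Theorems.ByReductionTypeAtTwoOrdEisensteinHalfShaIsogeny
import Summits.BirchSwinnertonDyer.Rank1Residual.X5.TwoAdicTargetsPub
import Summits.BirchSwinnertonDyer.Rank1Residual.X5.RationalTwoTorsionPoints
import Summits.BirchSwinnertonDyer.Rank1Residual.GreenbergMuConjecture
import Literature.NumberTheory.EllipticCurves.Rank1Residual.PeriodUnitProofs
import Literature.NumberTheory.EllipticCurves.ModularCurvePeriodRatio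
import Literature.NumberTheory.EllipticCurves.PAdicLFunctionIntegralityAtTwoProofs
import HarnessLib

/-!
# Route `AlignedTransportAtTwo`, crux C2 `MainConjectureOfRankZeroBSDAtTwo` (stmt-BirchSwinnertonDyer-22298, the SEED):
# the crux is EXACTLY Greenberg's `μ = 0` conjecture at `p = 2` on the seed cell, modulo the printed record

HONEST FRAMING (cell `bsd-f1-sign2`, HOME `run/shared/lean/pub/bsd-f1-sign2/`, prover seat `bsd-line-att-p2`,
line `birth` of the crux; BSD is NOT proved by any of this). THEOREMS ONLY — no definition, no named fact,
nothing asserted; every deep input is DISPLAYED as a hypothesis which is a PUBLISHED named fact of the tree: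

* `h17`  — Kato 2004, Thm. 17.4 (1)(2) AT `p = 2` (`kato_divisibility_allPrimes W 2`: `X(E/ℚ_∞)` is
  `Λ`-torsion and `char_Λ X ∣ 2ⁿ·L₂(f, α)` for SOME `n`; clause (3), integral, prints `p ≠ 2`);
* `hGr`  — Greenberg 1999, Thm. 4.1 parity-free (`Greenberg1999.thm41_charValue_rankZero_anyPrime`; the
  `p = 2` archimedean factor audited, D-audit of cell `bsd-2adic`);
* `hper` — the period unit at `2` for `E[2]` irreducible and good reduction at `2`
  (`realPeriodRat_eq_unit_mul_plusPeriod_two`: `Ω(W) = u·Ω⁺_f`, `|u|₂ = 1`; Abbes–Ullmo 1996 Thm. A +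
  Greenberg–Vatsal 2000 Rem. 3.4);
* `hmod` — modularity with a conductor-level newform (`nonempty_modularParametrizationData`);
* `hGZK` — Gross–Zagier–Kolyvagin (`rank_eq_analyticRank_of_analyticRank_le_one`).

WHAT IS PROVED (kernel-checked):

1. `mazurMainConjecture_two_of_bsdp_of_mu_eq_zero` — per curve: PRINT + {good ordinary at `2`, no rational
   point of order `2`, `r_an = 0`, `BSD(E,2)`, `μ(X(E/ℚ_∞)) = 0` for the cyclotomic data} ⟹
   `MazurMainConjecture W 2`. The engine is the tree's converse chain at `2`
   (`EisensteinShaCurrency.mazurMainConjecture_two_of_mu_eq_zero_of_missingLowerBoundAt`, cell `bsd-2adic`):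
   `μ = 0` upgrades Kato's `2ⁿ` to the INTEGRAL Kato half, `BSD(E,2)` gives the descent inequality
   `ord₂ #Ш_an ≤ ord₂ #Ш`, and Greenberg's Thm. 4.1 at `2` + interpolation make the cofactor a unit.
2. `mainConjectureOfRankZeroBSDAtTwo_of_seedMuZero` — the crux C2 from PRINT + the single non-print input
   «`μ₂(X(W/ℚ_∞)) = 0` for every seed-cell curve `W`» (the registered stub `stub_seedMuZeroAtTwo` of line
   `birth`), and `mainConjectureOfRankZeroBSDAtTwo_of_greenbergMuConjectureIrreducible` — C2 from PRINT + the
   tree's OPEN obligation node `Rank1Residual.GreenbergMuConjectureIrreducible` (Greenberg, LNM 1716,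
   Conj. 1.11, "in particular" clause), of which the stub is the `p = 2` seed-cell instance.
3. `mu_eq_zero_of_mazurMainConjecture_two` — NECESSITY: PRINT {`hper`, `hmod`} + the crux's own analytic
   hypothesis `μ(L₂) = 0` (`red G ≠ 0` for every even-branch lift `G`) + `MazurMainConjecture W 2` ⟹
   `μ(X(W/ℚ_∞)) = 0`. Hence `mainConjectureOfRankZeroBSDAtTwo_iff_seedMuZero`: modulo PRINT the crux C2 IS
   Greenberg's `μ`-conjecture at `2` on the seed cell — nothing weaker closes it, nothing stronger is needed
   — and the analytic `μ`-hypothesis of C2 is idle for sufficiency (it is FORCED by `μ_alg = 0` + PRINT).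
4. `mainConjectureOfRankZeroBSDAtTwo_certified` — the REPAIRED seed statement C2′ (C2 with the seed's
   per-curve `μ₂ = 0` certificate `X5.O1.TowerGapAtTwo W` as an extra hypothesis) is a THEOREM modulo PRINT.

Why the crux cannot close unconditionally here: `μ_alg(W, 2) = 0` for `E[2]` irreducible is OPEN (no
theorem in print at any prime for irreducible residual image; Kato's integral clause 17.4 (3), which
would transfer `μ_an = 0` to `μ_alg = 0`, excludes `p = 2`).

References: K. Kato, Astérisque 295 (2004), Thm. 17.4; R. Greenberg, LNM 1716 (1999), Thm. 4.1,
Conj. 1.11; A. Abbes, E. Ullmo, Compositio 103 (1996), Thm. A; R. Greenberg, V. Vatsal, Invent. Math.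
142 (2000), §3 Rem. 3.4 and p. 4; R. L. Miller, LMS J. Comput. Math. 14 (2011), Def. 1.1;
F. Castella, G. Grossi, C. Skinner, Math. Ann. 393 (2025), Introduction (MC).
-/

set_option linter.dupNamespace false
set_option autoImplicit false

noncomputable section

open scoped Classical MatrixGroups ModularForm

open CongruenceSubgroup WeierstrassCurve Literature.NumberTheory.EllipticCurves
  Literature.NumberTheory.EllipticCurves.ModularForms
  Literature.NumberTheory.EllipticCurves.Rank1Residual
  Literature.NumberTheory.EllipticCurves.Rank1Residual.Typed
  Literature.NumberTheory.EllipticCurves.Greenberg1999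
  Summit.BirchSwinnertonDyer.Rank1Residual
  Summit.BirchSwinnertonDyer.Rank1Residual.X1.MuLambda
  Summit.BirchSwinnertonDyer.Rank1Residual.X1.MuPart
  Summit.BirchSwinnertonDyer.Rank1Residual.X5
  Summit.BirchSwinnertonDyer.Rank1Residual.F1Sign2
  Summit.BirchSwinnertonDyer.BirchSwinnertonDyer.Theorems.Rank1ResidualX1Defs
  Summit.BirchSwinnertonDyer.BirchSwinnertonDyer.Theses.AlignedTransportAtTwo

namespace Summit.BirchSwinnertonDyer.BirchSwinnertonDyer.Theorems.AlignedTransportAtTwoSeed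

/-! ## §1 Bookkeeping: the cell's «no rational `2`-torsion» binder is `E[2]` irreducible -/

/-- A rational point of order `2` on `W` yields the tree predicate `HasRationalTwoTorsionX W x` at its
abscissa: `P = (x, y) = −P` forces `y = −y − a₁x − a₃`, i.e. `2y + a₁x + a₃ = 0` (Silverman AEC III.2.3).
[cite: SilvermanAEC2009, III.2.3] -/
theorem exists_hasRationalTwoTorsionX_of_addOrderOf_eq_two (W : WeierstrassCurve ℚ) [W.IsElliptic]
    {P : W.toAffine.Point} (hP : addOrderOf P = 2) : ∃ x : ℚ, HasRationalTwoTorsionX W x := by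
  have h2 : (2 : ℕ) • P = 0 := by rw [← hP]; exact addOrderOf_nsmul_eq_zero P
  have hP0 : P ≠ 0 := by
    rintro rfl
    rw [addOrderOf_zero] at hP
    exact absurd hP (by norm_num)
  rcases P with _ | ⟨x, y, hns⟩
  · exact absurd rfl hP0
  · refine ⟨x, y, hns.1, ?_⟩
    have hneg : (WeierstrassCurve.Affine.Point.some x y hns : W.toAffine.Point) =
        -WeierstrassCurve.Affine.Point.some x y hns :=
      eq_neg_of_add_eq_zero_left (by rwa [two_nsmul] at h2)
    rw [WeierstrassCurve.Affine.Point.neg_some, WeierstrassCurve.Affine.Point.some.injEq] at hneg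
    have hy : y = -y - W.a₁ * x - W.a₃ := hneg.2
    linear_combination hy

/-- **No rational point of order `2` ⟹ `E[2]` irreducible** (`Irr W 2`): the cell binder
`∀ x, ¬ HasRationalTwoTorsionX W x` of route `AlignedTransportAtTwo` in the tree's image currency
(`X5.O1.irr_two_iff_not_exists_addOrderOf_eq_two`). [cite: SilvermanAEC2009, III.2.3] -/
theorem irr_two_of_forall_not_hasRationalTwoTorsionX (W : WeierstrassCurve ℚ) [W.IsElliptic]
    (ht : ∀ x : ℚ, ¬ HasRationalTwoTorsionX W x) : Irr W 2 := by
  rw [O1.irr_two_iff_not_exists_addOrderOf_eq_two]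
  rintro ⟨P, hP⟩
  obtain ⟨x, hx⟩ := exists_hasRationalTwoTorsionX_of_addOrderOf_eq_two W hP
  exact ht x hx

/-! ## §2 Bookkeeping: the two print-shaped inputs of the engine on the cell -/

section Inputs

variable (W : WeierstrassCurve ℚ) [W.IsElliptic] [W.IsGloballyMinimal]

omit [W.IsGloballyMinimal] in
/-- **`BSD(E,p)` ⟹ the descent inequality `ord_p #Ш_an ≤ ord_p #Ш`** (`MissingLowerBoundAt W p`) in
analytic rank `≤ 1` (GZK `hGZK` for the finiteness of `Ш`, so that `ord_p #Ш(p) = ord_p #Ш`).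
[cite: Miller2011LMS, Def. 1.1 (arXiv:1010.2431 p. 3)] -/
theorem missingLowerBoundAt_of_bsdp (hGZK : rank_eq_analyticRank_of_analyticRank_le_one) (p : ℕ)
    [Fact p.Prime] (hr : W.analyticRank ≤ 1) (h : BSDp W p) : MissingLowerBoundAt W p := by
  haveI : Finite W.sha := (hGZK W hr).2
  exact (Typed.lower_and_upper_of_missingPPartAt W p (Typed.missingPPartAt_of_bsdp W p h)).1

/-- **Néron-period integrality at `2` from the period-unit fact** (`hper` =
`realPeriodRat_eq_unit_mul_plusPeriod_two`: `Ω(W) = u·Ω⁺_f`, `|u|₂ = 1`, for `W` good at `2` with `E[2]`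
irreducible): every `ϖ ∈ ℚ` with `ϖ·Ω(W) = Ω⁺_f` has `ord₂ ϖ = 0`, in particular `0 ≤ ord₂ ϖ` — the `hper₀`
binder of the `bsd-2adic` engine. [cite: AbbesUllmo1996, Thm. A] [cite: GreenbergVatsal2000, §3, Remark 3.4] -/
theorem padicValRat_periodRatio_eq_zero_two (hper : realPeriodRat_eq_unit_mul_plusPeriod_two)
    (hgood : W.HasGoodReductionAtPrime 2) (hirr : Irr W 2) {N : ℕ} [NeZero N]
    (f : CuspForm (Gamma0 N) 2) (hf : IsNewformOf W f) (ϖ : ℚ)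
    (hϖ : (ϖ : ℝ) * W.realPeriodRat = plusPeriod f) : padicValRat 2 ϖ = 0 := by
  obtain ⟨u, hu, hΩ⟩ := hper W hgood hirr f hf
  exact Rank1Residual.padicValRat_periodRatio_eq_zero_of_eq_unit_mul W 2 f hu hΩ ϖ hϖ

end Inputs

/-! ## §3 SUFFICIENCY per curve: PRINT + `BSD(E,2)` + `μ₂(X) = 0` ⟹ Mazur's `2`-adic main conjecture -/

section PerCurve

variable (W : WeierstrassCurve ℚ) [W.IsElliptic] [W.IsGloballyMinimal]

/-- **The SEED, per curve.** Let `W/ℚ` be globally minimal, good ordinary at `2`, with no rational point of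
order `2`, of analytic rank `0`, with `BSD(E,2)` (Miller) known. Granted PRINT — Kato 17.4 (1)(2) at `2` for
`W` (`h17`), Greenberg Thm. 4.1 parity-free (`hGr`), the period unit at `2` (`hper`), modularity (`hmod`),
Gross–Zagier–Kolyvagin (`hGZK`) — and `μ(X(E/ℚ_∞)) = 0` for every `Λ`-torsion cyclotomic dual datum
(`hμ`): Mazur's `2`-adic main conjecture `MazurMainConjecture W 2` (Néron normalisation, every datum).
Proof: `E[2]` irreducible (§1) gives Néron integrality (`hper`), `BSD(E,2)` gives `ord₂ #Ш_an ≤ ord₂ #Ш`,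
Kato 17.4 (1) makes every cyclotomic `X` torsion so `hμ` applies, and the `bsd-2adic` engine
`EisensteinShaCurrency.mazurMainConjecture_two_of_mu_eq_zero_of_missingLowerBoundAt` concludes.
[cite: Kato2004Asterisque, Thm. 17.4 (1)(2) (p. 273)] [cite: GreenbergLNM1716, Thm. 4.1 (p. 102) and §5 (closing examples)]
[cite: Miller2011LMS, Def. 1.1] -/
theorem mazurMainConjecture_two_of_bsdp_of_mu_eq_zero
    (h17 : ∀ [NeZero (W.conductorNorm ℤ)] (f : CuspForm (Gamma0 (W.conductorNorm ℤ)) 2),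
      kato_divisibility_allPrimes W 2 (f := f))
    (hGr : Greenberg1999.thm41_charValue_rankZero_anyPrime)
    (hper : realPeriodRat_eq_unit_mul_plusPeriod_two) (hmod : nonempty_modularParametrizationData)
    (hGZK : rank_eq_analyticRank_of_analyticRank_le_one) (hord : IsOrdinaryAt W 2)
    (ht : ∀ x : ℚ, ¬ HasRationalTwoTorsionX W x) (hr : W.analyticRank = 0) (hbsd : BSDp W 2)
    (hμ : ∀ (κ : ZpExtension ℚ 2) (γ : Field.absoluteGaloisGroup ℚ), κ.IsCyclotomic →
      κ.IsTopGenerator γ → IsCyclotomicVariable 2 γ →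
      ∀ D : W.SelmerDualData κ γ, D.IsTorsion → D.mu = 0) :
    MazurMainConjecture W 2 := by
  have hirr : Irr W 2 := irr_two_of_forall_not_hasRationalTwoTorsionX W ht
  have hgo : GoodOrd W 2 := hord
  have hsha : MissingLowerBoundAt W 2 :=
    missingLowerBoundAt_of_bsdp W hGZK 2 (by rw [hr]; exact zero_le_one) hbsd
  have hμ' : ∀ (κ : ZpExtension ℚ 2) (γ : Field.absoluteGaloisGroup ℚ), κ.IsCyclotomic →
      κ.IsTopGenerator γ → IsCyclotomicVariable 2 γ → ∀ D : W.SelmerDualData κ γ, D.mu = 0 := by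
    intro κ γ hκ hγ hγ' D
    haveI : NeZero (W.conductorNorm ℤ) := ⟨(W.conductorNorm_pos_holds).ne'⟩
    obtain ⟨Dm⟩ := hmod W
    exact hμ κ γ hκ hγ hγ' D (h17 Dm.f κ γ hκ hγ hγ' hord Dm.isNewformOf D).1
  exact EisensteinShaCurrency.mazurMainConjecture_two_of_mu_eq_zero_of_missingLowerBoundAt W h17
    (fun f hf ϖ hϖ => (padicValRat_periodRatio_eq_zero_two W hper hord.1 hirr f hf ϖ hϖ).ge)
    (O1.twoAdicEulerCharRankZero_zero_of_greenberg W hGr) hGZK hmod hgo hr hμ' hsha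

/-- **The REPAIRED seed statement, per curve (C2′): with a `μ₂ = 0` CERTIFICATE the seed is a theorem of
the printed record.** Same as `mazurMainConjecture_two_of_bsdp_of_mu_eq_zero` with `μ(X) = 0` supplied by
the per-curve tower-gap certificate `X5.O1.TowerGapAtTwo W` (one gap `#(X/(2,T^{m+k})X) < 2^k·#(X/(2,T^m)X)`,
decidable from layer Selmer counts; `X5.O1.isTorsion_and_mu_eq_zero_of_towerGapAtTwo`).
[cite: Washington1997, §13.2] [cite: Kato2004Asterisque, Thm. 17.4 (1)(2) (p. 273)] [cite: GreenbergLNM1716, Thm. 4.1 (p. 102)] -/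
theorem mazurMainConjecture_two_of_bsdp_of_towerGap
    (h17 : ∀ [NeZero (W.conductorNorm ℤ)] (f : CuspForm (Gamma0 (W.conductorNorm ℤ)) 2),
      kato_divisibility_allPrimes W 2 (f := f))
    (hGr : Greenberg1999.thm41_charValue_rankZero_anyPrime)
    (hper : realPeriodRat_eq_unit_mul_plusPeriod_two) (hmod : nonempty_modularParametrizationData)
    (hGZK : rank_eq_analyticRank_of_analyticRank_le_one) (hord : IsOrdinaryAt W 2)
    (ht : ∀ x : ℚ, ¬ HasRationalTwoTorsionX W x) (hr : W.analyticRank = 0) (hbsd : BSDp W 2)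
    (hgap : O1.TowerGapAtTwo W) : MazurMainConjecture W 2 :=
  mazurMainConjecture_two_of_bsdp_of_mu_eq_zero W h17 hGr hper hmod hGZK hord ht hr hbsd
    fun _ _ hκ hγ hγ' D _ => (O1.isTorsion_and_mu_eq_zero_of_towerGapAtTwo W hgap hκ hγ hγ' D).2

end PerCurve

/-! ## §4 NECESSITY per curve: the main conjecture + `μ(L₂) = 0` force `μ₂(X) = 0` -/

section Necessity

variable (W : WeierstrassCurve ℚ) [W.IsElliptic] [W.IsGloballyMinimal]

/-- `red G ≠ 0 ⟹ μ(G) = 0` (`2 ∤ G` in `Λ`; `μ` = the exact power of `2` dividing `G`). [folklore] -/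
theorem mu_eq_zero_of_red_ne_zero {p : ℕ} [Fact p.Prime] {G : IwasawaAlgebra p} (hG : red G ≠ 0) :
    mu G = 0 := by
  have hG0 : G ≠ 0 := by rintro rfl; exact hG (by simp [red])
  by_contra hμ
  have hdvd : PowerSeries.C ((p : ℤ_[p]) ^ mu G) ∣ G := C_pow_mu_dvd hG0
  have h1 : PowerSeries.C (p : ℤ_[p]) ∣ G :=
    (map_dvd (PowerSeries.C (R := ℤ_[p])) (dvd_pow_self (p : ℤ_[p]) hμ)).trans hdvd
  exact hG ((red_eq_zero_iff G).mpr h1)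

/-- `μ` is blind to a `2`-adic unit constant: `μ(C c · G) = μ(G)` for `c ∈ ℤ_pˣ`, `G ≠ 0`. [folklore] -/
theorem mu_C_mul_of_isUnit {p : ℕ} [Fact p.Prime] {c : ℤ_[p]} (hc : IsUnit c) {G : IwasawaAlgebra p}
    (hG : G ≠ 0) : mu (PowerSeries.C c * G) = mu G := by
  have hCu : IsUnit (PowerSeries.C c : IwasawaAlgebra p) := hc.map _
  rw [mu_mul hCu.ne_zero hG, ((isUnit_iff_mu_eq_zero_and_lam_eq_zero _).mp hCu).2.1, zero_add]

/-- **NECESSITY.** Let `W/ℚ` be globally minimal, good ordinary at `2`, with no rational point of order `2`.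
Granted PRINT — the period unit at `2` (`hper`) and modularity (`hmod`) — the crux's own ANALYTIC hypothesis
(`hμan`: every integral lift `G` of the even-branch `2`-adic `L`-function of any newform of `W` has
`red G ≠ 0`, i.e. `μ(L₂(f, α)) = 0`) and Mazur's `2`-adic main conjecture `MazurMainConjecture W 2` FORCE
`μ(X(E/ℚ_∞)) = 0` for every cyclotomic dual datum: `char X = (g)` with `ι g = ϖ·L₂(f,α) = ϖ·ι G`
(`G` the integral lift, which EXISTS for `E[2]` irreducible — tree theorem
`exists_iwasawaToPowerSeries_eq_padicLFunction_two`), `ϖ ∈ ℤ₂ˣ` (`hper`), so `g = ϖ·G`,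
`μ(X) = μ(g) = μ(G) = 0`. So nothing WEAKER than `μ_alg = 0` can deliver the crux.
[cite: GreenbergVatsal2000, p. 2 (2) and p. 4] [cite: AbbesUllmo1996, Thm. A] -/
theorem mu_eq_zero_of_mazurMainConjecture_two (hper : realPeriodRat_eq_unit_mul_plusPeriod_two)
    (hmod : nonempty_modularParametrizationData) (hord : IsOrdinaryAt W 2)
    (ht : ∀ x : ℚ, ¬ HasRationalTwoTorsionX W x)
    (hμan : ∀ ⦃N : ℕ⦄ [NeZero N] (f : CuspForm (Gamma0 N) 2), IsNewformOf W f →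
      ∀ G : IwasawaAlgebra 2, IsEvenBranchLiftAtTwo W f G → red G ≠ 0)
    (hMC : MazurMainConjecture W 2) :
    ∀ (κ : ZpExtension ℚ 2) (γ : Field.absoluteGaloisGroup ℚ), κ.IsCyclotomic →
      κ.IsTopGenerator γ → IsCyclotomicVariable 2 γ → ∀ D : W.SelmerDualData κ γ, D.mu = 0 := by
  intro κ γ hκ hγ hγ' D
  have hirr : Irr W 2 := irr_two_of_forall_not_hasRationalTwoTorsionX W ht
  haveI : NeZero (W.conductorNorm ℤ) := ⟨(W.conductorNorm_pos_holds).ne'⟩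
  obtain ⟨Dm⟩ := hmod W
  have hf : IsNewformOf W Dm.f := Dm.isNewformOf
  -- the Néron ratio `ϖ = u⁻¹`, a `2`-adic unit
  obtain ⟨u, hu, hΩ⟩ := hper W hord.1 hirr Dm.f hf
  have hΩpos : 0 < W.realPeriodRat := W.realPeriodRat_pos_holds
  have hu0 : u ≠ 0 := by
    rintro rfl
    rw [Rat.cast_zero, zero_mul] at hΩ
    exact hΩpos.ne' hΩ
  set ϖ : ℚ := u⁻¹ with hϖ_def
  have hϖ : (ϖ : ℝ) * W.realPeriodRat = plusPeriod Dm.f := by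
    rw [hΩ, hϖ_def, Rat.cast_inv, ← mul_assoc, inv_mul_cancel₀ (by exact_mod_cast hu0), one_mul]
  have hϖnorm : ‖(ϖ : ℚ_[2])‖ = 1 := by
    rw [hϖ_def, Rat.cast_inv, norm_inv, hu, inv_one]
  -- the main conjecture at the datum `(κ, γ, f, ϖ, D)`
  haveI : Module.Finite (IwasawaAlgebra 2) D.X := D.module_finite_holds hγ
  obtain ⟨hX, g, hchar, hιg⟩ := hMC κ γ hκ hγ hγ' Dm.f hf ϖ hϖ D
  -- the integral lift `G` of `L₂(f, α)` (exists: `E[2]` irreducible) has `μ(G) = 0` by `hμan`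
  obtain ⟨G, hG⟩ := exists_iwasawaToPowerSeries_eq_padicLFunction_two hord hf hirr
  have hredG : red G ≠ 0 := hμan Dm.f hf G (Or.inl ⟨hord, hG⟩)
  have hG0 : G ≠ 0 := by rintro rfl; exact hredG (by simp [red])
  -- `g = ϖ' · G` with `ϖ' ∈ ℤ₂ˣ`
  set ϖ' : ℤ_[2] := ⟨(ϖ : ℚ_[2]), hϖnorm.le⟩ with hϖ'_def
  have hϖ'u : IsUnit ϖ' := PadicInt.isUnit_iff.mpr (by rw [hϖ'_def]; exact hϖnorm)
  have hg : g = PowerSeries.C ϖ' * G := by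
    apply iwasawaToPowerSeries_injective 2
    rw [hιg, map_mul, ← hG, iwasawaToPowerSeries, PowerSeries.map_C]
    rfl
  have hg0 : g ≠ 0 := by rw [hg]; exact mul_ne_zero (hϖ'u.map _).ne_zero hG0
  -- `μ(X) = μ(g) = μ(G) = 0`
  have h1 : mu g = D.mu := mu_generator_eq_muInvariant D.X hX hg0 hchar
  rw [← h1, hg, mu_C_mul_of_isUnit hϖ'u hG0]
  exact mu_eq_zero_of_red_ne_zero hredG

end Necessity

/-! ## §5 The crux by name: C2 ⟸ PRINT + (seed `μ₂ = 0`); C2 ⟸ PRINT + Greenberg's conjecture; C2 ⟺ seed `μ₂ = 0` -/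

section Crux

/-- **C2 from PRINT + the seed-cell `μ₂ = 0` statement** (= the registered stub `stub_seedMuZeroAtTwo` of
line `birth`, written out: for every seed-cell curve `W` — non-CM, good ordinary at `2`, no rational point
of order `2`, `Δ ∉ ℚ²`, `r_an = 0`, analytic `μ₂ = 0`, `BSD(W,2)` — and every `Λ`-torsion cyclotomic dual
datum `D`, `D.mu = 0`). PRINT: Kato 17.4 (1)(2) at `2` (`h17`, every curve), Greenberg 4.1 (`hGr`), the
period unit (`hper`), modularity (`hmod`), GZK (`hGZK`). The hypotheses `¬ HasCM`, `Δ ∉ ℚ²` and the analytic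
`μ₂ = 0` of C2 are passed to the stub and otherwise unused. [cite: Kato2004Asterisque, Thm. 17.4 (1)(2) (p. 273)]
[cite: GreenbergLNM1716, Thm. 4.1 (p. 102), §1 Conj. 1.11 (p. 58)] -/
theorem mainConjectureOfRankZeroBSDAtTwo_of_seedMuZero
    (h17 : ∀ (V : WeierstrassCurve ℚ) [V.IsElliptic] [V.IsGloballyMinimal] [NeZero (V.conductorNorm ℤ)]
      (f : CuspForm (Gamma0 (V.conductorNorm ℤ)) 2), kato_divisibility_allPrimes V 2 (f := f))
    (hGr : Greenberg1999.thm41_charValue_rankZero_anyPrime)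
    (hper : realPeriodRat_eq_unit_mul_plusPeriod_two) (hmod : nonempty_modularParametrizationData)
    (hGZK : rank_eq_analyticRank_of_analyticRank_le_one)
    (hT : ∀ (W : WeierstrassCurve ℚ) [W.IsElliptic] [W.IsGloballyMinimal], ¬ W.HasCM →
      IsOrdinaryAt W 2 → (∀ x : ℚ, ¬ HasRationalTwoTorsionX W x) → ¬ IsSquare W.Δ →
      W.analyticRank = 0 →
      (∀ ⦃N : ℕ⦄ [NeZero N] (f : CuspForm (Gamma0 N) 2), IsNewformOf W f →
        ∀ G : IwasawaAlgebra 2, IsEvenBranchLiftAtTwo W f G → red G ≠ 0) →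
      BSDp W 2 →
      ∀ (κ : ZpExtension ℚ 2) (γ : Field.absoluteGaloisGroup ℚ), κ.IsCyclotomic →
        κ.IsTopGenerator γ → IsCyclotomicVariable 2 γ →
        ∀ D : W.SelmerDualData κ γ, D.IsTorsion → D.mu = 0) :
    MainConjectureOfRankZeroBSDAtTwo := by
  intro W _ _ hcm hord ht hsq hr hμan hbsd
  exact mazurMainConjecture_two_of_bsdp_of_mu_eq_zero W (fun f => h17 W f) hGr hper hmod hGZK hord ht
    hr hbsd (hT W hcm hord ht hsq hr hμan hbsd)

/-- **C2 from PRINT + Greenberg's `μ`-conjecture (irreducible form).** The tree's OPEN obligation node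
`Rank1Residual.GreenbergMuConjectureIrreducible` (Greenberg, LNM 1716, Conj. 1.11, "In particular, if
`E[p]` is irreducible … then `μ_E = 0`", every prime `p`) supplies the stub at `p = 2` (the cell has `E[2]`
irreducible: no rational point of order `2`), hence C2 modulo PRINT. CONDITIONAL result: the crux item
stmt-BirchSwinnertonDyer-22298 stays open; it hinges on this one named obligation.
[cite: GreenbergLNM1716, §1 Conj. 1.11 (p. 58)] [cite: Kato2004Asterisque, Thm. 17.4 (1)(2) (p. 273)] -/
theorem mainConjectureOfRankZeroBSDAtTwo_of_greenbergMuConjectureIrreducible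
    (h17 : ∀ (V : WeierstrassCurve ℚ) [V.IsElliptic] [V.IsGloballyMinimal] [NeZero (V.conductorNorm ℤ)]
      (f : CuspForm (Gamma0 (V.conductorNorm ℤ)) 2), kato_divisibility_allPrimes V 2 (f := f))
    (hGr : Greenberg1999.thm41_charValue_rankZero_anyPrime)
    (hper : realPeriodRat_eq_unit_mul_plusPeriod_two) (hmod : nonempty_modularParametrizationData)
    (hGZK : rank_eq_analyticRank_of_analyticRank_le_one) (hG : GreenbergMuConjectureIrreducible) :
    MainConjectureOfRankZeroBSDAtTwo :=
  mainConjectureOfRankZeroBSDAtTwo_of_seedMuZero h17 hGr hper hmod hGZK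
    fun W _ _ _ _ ht _ _ _ _ κ γ hκ hγ _ D hD =>
      hG W 2 κ γ hκ hγ (irr_two_of_forall_not_hasRationalTwoTorsionX W ht) D hD

/-- **C2 ⟺ the seed-cell `μ₂ = 0` statement, modulo PRINT.** Granted Kato 17.4 (1)(2) at `2`, Greenberg
4.1, the period unit at `2`, modularity and GZK: the crux `MainConjectureOfRankZeroBSDAtTwo` holds IF AND
ONLY IF every seed-cell curve has `μ(X(W/ℚ_∞)) = 0` at every `Λ`-torsion cyclotomic dual datum. (⇐ §3;
⇒ §4, which uses the crux's analytic `μ₂ = 0` hypothesis and the period unit.) So the crux is EXACTLY the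
`p = 2`, seed-cell instance of Greenberg's Conj. 1.11 — the line's hardest stub is the whole crux, and the
planner's kill criterion «restate C2 with a certified `μ_alg = 0` hypothesis» is the only repair
(`mainConjectureOfRankZeroBSDAtTwo_certified`). [cite: GreenbergLNM1716, §1 Conj. 1.11 (p. 58) and Thm. 4.1 (p. 102)]
[cite: GreenbergVatsal2000, p. 4] -/
theorem mainConjectureOfRankZeroBSDAtTwo_iff_seedMuZero
    (h17 : ∀ (V : WeierstrassCurve ℚ) [V.IsElliptic] [V.IsGloballyMinimal] [NeZero (V.conductorNorm ℤ)]
      (f : CuspForm (Gamma0 (V.conductorNorm ℤ)) 2), kato_divisibility_allPrimes V 2 (f := f))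
    (hGr : Greenberg1999.thm41_charValue_rankZero_anyPrime)
    (hper : realPeriodRat_eq_unit_mul_plusPeriod_two) (hmod : nonempty_modularParametrizationData)
    (hGZK : rank_eq_analyticRank_of_analyticRank_le_one) :
    MainConjectureOfRankZeroBSDAtTwo ↔
      ∀ (W : WeierstrassCurve ℚ) [W.IsElliptic] [W.IsGloballyMinimal], ¬ W.HasCM →
        IsOrdinaryAt W 2 → (∀ x : ℚ, ¬ HasRationalTwoTorsionX W x) → ¬ IsSquare W.Δ →
        W.analyticRank = 0 →
        (∀ ⦃N : ℕ⦄ [NeZero N] (f : CuspForm (Gamma0 N) 2), IsNewformOf W f →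
          ∀ G : IwasawaAlgebra 2, IsEvenBranchLiftAtTwo W f G → red G ≠ 0) →
        BSDp W 2 →
        ∀ (κ : ZpExtension ℚ 2) (γ : Field.absoluteGaloisGroup ℚ), κ.IsCyclotomic →
          κ.IsTopGenerator γ → IsCyclotomicVariable 2 γ →
          ∀ D : W.SelmerDualData κ γ, D.IsTorsion → D.mu = 0 := by
  refine ⟨fun hC2 W _ _ hcm hord ht hsq hr hμan hbsd κ γ hκ hγ hγ' D _ => ?_,
    mainConjectureOfRankZeroBSDAtTwo_of_seedMuZero h17 hGr hper hmod hGZK⟩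
  exact mu_eq_zero_of_mazurMainConjecture_two W hper hmod hord ht hμan
    (hC2 W hcm hord ht hsq hr hμan hbsd) κ γ hκ hγ hγ' D

/-- **The REPAIRED crux C2′ is a theorem modulo PRINT**: C2 restricted to seeds carrying the per-curve
`μ₂ = 0` certificate `X5.O1.TowerGapAtTwo W` (the planner's pivot «seeds with CERTIFIED `μ_alg = 0`»).
Every other binder of C2 is kept verbatim. [cite: Washington1997, §13.2] [cite: Kato2004Asterisque, Thm. 17.4 (1)(2) (p. 273)]
[cite: GreenbergLNM1716, Thm. 4.1 (p. 102)] -/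
theorem mainConjectureOfRankZeroBSDAtTwo_certified
    (h17 : ∀ (V : WeierstrassCurve ℚ) [V.IsElliptic] [V.IsGloballyMinimal] [NeZero (V.conductorNorm ℤ)]
      (f : CuspForm (Gamma0 (V.conductorNorm ℤ)) 2), kato_divisibility_allPrimes V 2 (f := f))
    (hGr : Greenberg1999.thm41_charValue_rankZero_anyPrime)
    (hper : realPeriodRat_eq_unit_mul_plusPeriod_two) (hmod : nonempty_modularParametrizationData)
    (hGZK : rank_eq_analyticRank_of_analyticRank_le_one) :
    ∀ (W : WeierstrassCurve ℚ) [W.IsElliptic] [W.IsGloballyMinimal], ¬ W.HasCM →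
      IsOrdinaryAt W 2 → (∀ x : ℚ, ¬ HasRationalTwoTorsionX W x) → ¬ IsSquare W.Δ →
      W.analyticRank = 0 →
      (∀ ⦃N : ℕ⦄ [NeZero N] (f : CuspForm (Gamma0 N) 2), IsNewformOf W f →
        ∀ G : IwasawaAlgebra 2, IsEvenBranchLiftAtTwo W f G → red G ≠ 0) →
      BSDp W 2 → O1.TowerGapAtTwo W → MazurMainConjecture W 2 :=
  fun W _ _ _ hord ht _ hr _ hbsd hgap =>
    mazurMainConjecture_two_of_bsdp_of_towerGap W (fun f => h17 W f) hGr hper hmod hGZK hord ht hr hbsd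
      hgap

end Crux

end Summit.BirchSwinnertonDyer.BirchSwinnertonDyer.Theorems.AlignedTransportAtTwoSeed

end
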